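import Summits.CriticalPhenomena.SAWScalingLimit.Theorems.ObservableToSLE.Negative.Identification
import Literature.Probability.RandomPlanarGeometry.HexDomainSingleton
import Literature.Probability.LatticeModels.TriangularLatticeProofs
import Literature.Probability.Percolation.TriLoopWinding
import HarnessLib

/-!
# Crux `SAWDevelopingMap.ObservableToSLE` (stmt-CriticalPhenomena-10472), line
`floor-ratio-restriction-bootstrap`, stub `stub_canonicalTransfer`: greedy descent on the
honeycomb lattice (lattice topology for the inner admissible discretisation (M1))

Landing target:
`Summits/CriticalPhenomena/SAWScalingLimit/Theorems/SAWDevelopingMapObservableToSLECanonicalTransferGreedy.lean`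
(`--supports stmt-CriticalPhenomena-10472`).

The discretisation input (M1) of `canonicalTransfer_ofDiscretisation`
(`…CanonicalTransferAssembly.lean`) asks for inner admissible vertex domains of a floor Jordan
domain: connected, simply connected (connected complement), without bad edges, exhausting the
compacts.  Every lattice-connectivity step of that construction (following a continuous path or an
`η`-chain by lattice vertices, escaping from a boundary collar to the exterior, joining far-away
vertices outside a large ball) reduces to ONE primitive, proved here: **greedy descent** — from any
honeycomb vertex one can walk towards any target point `y ∈ ℂ`, strictly decreasing the distance to
`y` at every step, until within one edge length `1/√3` of `y`; in particular the whole walk stays in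
the closed disc around `y` through the starting vertex.

* `exists_adj_normSq_lt` — the descent step: if `|y - c_u| > 1/√3`, one of the three neighbours of
  `u` is strictly closer to `y` (the three edge directions are `120°` apart, so one of them makes an
  angle `≤ 60°` with `y - c_u`);
* `exists_walk_dist_le` — greedy descent (well-founded on the finitely many lattice vertices closer
  to `y`); `exists_walk_dist_smul_le` = registered sub-goal `stub_canonicalTransfer_greedyPath` —
  the rescaled form at mesh `δ`: a walk from `v` ending within `δ/√3` of `y` along which
  `dist (δ c_u) y ≤ dist (δ c_v) y`.
-/

noncomputable section

open scoped Topology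
open Filter Set Metric
open Literature.Probability.LatticeModels (HexVertex hexGraph hexCenter Site
  hexGraph_adj_iff_of_snd_eq_zero_holds hexGraph_adj_iff_of_snd_eq_one)
open Literature.Probability.RandomPlanarGeometry
open Literature.Probability.RandomPlanarGeometry.SAW
open Literature.Probability.Percolation (hexCenter_re hexCenter_im)

namespace Summit.CriticalPhenomena.SAWScalingLimit.Theorems.ObservableToSLE.FloorRatio

open Summit.CriticalPhenomena.SAWScalingLimit.Theorems.ObservableToSLE.Negative
  (finite_embMeshVertices_hex)

/-! ### Coordinates of the three neighbours -/

/-- Squared distance in coordinates. [folklore] -/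
private theorem normSq_sub_eq (y c : ℂ) :
    Complex.normSq (y - c) = (y.re - c.re) ^ 2 + (y.im - c.im) ^ 2 := by
  rw [Complex.normSq_apply, Complex.sub_re, Complex.sub_im]; ring

/-- The three neighbours of an up-face `(x, 0)` sit at offsets `(1/2, √3/6)`, `(-1/2, √3/6)`,
`(0, -√3/3)` from its centre. [folklore] -/
private theorem up_neighbours (x : Site 2) :
    (hexGraph.Adj (x, (0 : Fin 2)) (x, 1) ∧
      (hexCenter (x, (1 : Fin 2))).re = (hexCenter (x, (0 : Fin 2))).re + 1 / 2 ∧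
      (hexCenter (x, (1 : Fin 2))).im = (hexCenter (x, (0 : Fin 2))).im + Real.sqrt 3 / 6) ∧
    (hexGraph.Adj (x, (0 : Fin 2)) (x - Pi.single 0 1, 1) ∧
      (hexCenter (x - Pi.single 0 1, (1 : Fin 2))).re = (hexCenter (x, (0 : Fin 2))).re - 1 / 2 ∧
      (hexCenter (x - Pi.single 0 1, (1 : Fin 2))).im =
        (hexCenter (x, (0 : Fin 2))).im + Real.sqrt 3 / 6) ∧
    (hexGraph.Adj (x, (0 : Fin 2)) (x - Pi.single 1 1, 1) ∧
      (hexCenter (x - Pi.single 1 1, (1 : Fin 2))).re = (hexCenter (x, (0 : Fin 2))).re ∧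
      (hexCenter (x - Pi.single 1 1, (1 : Fin 2))).im =
        (hexCenter (x, (0 : Fin 2))).im - Real.sqrt 3 / 3) := by
  refine ⟨⟨(hexGraph_adj_iff_of_snd_eq_zero_holds x x).2 (Or.inl rfl), ?_, ?_⟩,
    ⟨(hexGraph_adj_iff_of_snd_eq_zero_holds x _).2 (Or.inr (Or.inl rfl)), ?_, ?_⟩,
    ⟨(hexGraph_adj_iff_of_snd_eq_zero_holds x _).2 (Or.inr (Or.inr rfl)), ?_, ?_⟩⟩ <;>
    simp [hexCenter_re, hexCenter_im, Pi.sub_apply] <;> ring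

/-- The three neighbours of a down-face `(x, 1)` sit at offsets `(-1/2, -√3/6)`, `(1/2, -√3/6)`,
`(0, √3/3)` from its centre. [folklore] -/
private theorem down_neighbours (x : Site 2) :
    (hexGraph.Adj (x, (1 : Fin 2)) (x, 0) ∧
      (hexCenter (x, (0 : Fin 2))).re = (hexCenter (x, (1 : Fin 2))).re - 1 / 2 ∧
      (hexCenter (x, (0 : Fin 2))).im = (hexCenter (x, (1 : Fin 2))).im - Real.sqrt 3 / 6) ∧
    (hexGraph.Adj (x, (1 : Fin 2)) (x + Pi.single 0 1, 0) ∧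
      (hexCenter (x + Pi.single 0 1, (0 : Fin 2))).re = (hexCenter (x, (1 : Fin 2))).re + 1 / 2 ∧
      (hexCenter (x + Pi.single 0 1, (0 : Fin 2))).im =
        (hexCenter (x, (1 : Fin 2))).im - Real.sqrt 3 / 6) ∧
    (hexGraph.Adj (x, (1 : Fin 2)) (x + Pi.single 1 1, 0) ∧
      (hexCenter (x + Pi.single 1 1, (0 : Fin 2))).re = (hexCenter (x, (1 : Fin 2))).re ∧
      (hexCenter (x + Pi.single 1 1, (0 : Fin 2))).im =
        (hexCenter (x, (1 : Fin 2))).im + Real.sqrt 3 / 3) := by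
  refine ⟨⟨(hexGraph_adj_iff_of_snd_eq_one x x).2 (Or.inl rfl), ?_, ?_⟩,
    ⟨(hexGraph_adj_iff_of_snd_eq_one x _).2 (Or.inr (Or.inl rfl)), ?_, ?_⟩,
    ⟨(hexGraph_adj_iff_of_snd_eq_one x _).2 (Or.inr (Or.inr rfl)), ?_, ?_⟩⟩ <;>
    simp [hexCenter_re, hexCenter_im, Pi.add_apply] <;> ring

/-! ### The descent step -/

/-- The planar inequality behind the descent step: for `p² + q² > 1/3` one of the three offsets
`(1/2, s/6)`, `(-1/2, s/6)`, `(0, -s/3)` (`s = √3`) has inner product with `(p, q)` exceeding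
`1/6`, i.e. moving by it strictly decreases the squared distance to `(p, q)`. [folklore] -/
private theorem descent_ineq {p q : ℝ} (h : 1 / 3 < p ^ 2 + q ^ 2) :
    (p - 1 / 2) ^ 2 + (q - Real.sqrt 3 / 6) ^ 2 < p ^ 2 + q ^ 2 ∨
      (p + 1 / 2) ^ 2 + (q - Real.sqrt 3 / 6) ^ 2 < p ^ 2 + q ^ 2 ∨
        p ^ 2 + (q + Real.sqrt 3 / 3) ^ 2 < p ^ 2 + q ^ 2 := by
  have hs : Real.sqrt 3 ^ 2 = 3 := Real.sq_sqrt (by norm_num)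
  have hs0 : 0 < Real.sqrt 3 := Real.sqrt_pos.2 (by norm_num)
  by_cases hq : Real.sqrt 3 * q ≤ -p ∧ Real.sqrt 3 * q ≤ p
  · -- straight down
    refine Or.inr (Or.inr ?_)
    nlinarith [hq.1, hq.2, sq_nonneg p, sq_nonneg (Real.sqrt 3 * q + p),
      sq_nonneg (Real.sqrt 3 * q - p)]
  · rw [not_and_or, not_le, not_le] at hq
    by_cases hp : 0 ≤ p
    · refine Or.inl ?_
      have hq' : -p < Real.sqrt 3 * q := by
        rcases hq with hq | hq
        · exact hq
        · linarith
      nlinarith [sq_nonneg (Real.sqrt 3 * q), sq_nonneg (p - 1 / 2)]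
    · refine Or.inr (Or.inl ?_)
      push Not at hp
      have hq' : p < Real.sqrt 3 * q := by
        rcases hq with hq | hq
        · linarith
        · exact hq
      nlinarith [sq_nonneg (Real.sqrt 3 * q), sq_nonneg (p + 1 / 2)]

/-- **The descent step.**  If the honeycomb vertex `u` is farther than one edge length from the
point `y` (`|y - c_u|² > 1/3`), one of its three neighbours is strictly closer to `y`. [folklore] -/
theorem exists_adj_normSq_lt (u : HexVertex) (y : ℂ)
    (h : 1 / 3 < Complex.normSq (y - hexCenter u)) :
    ∃ u' : HexVertex, hexGraph.Adj u u' ∧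
      Complex.normSq (y - hexCenter u') < Complex.normSq (y - hexCenter u) := by
  obtain ⟨x, k⟩ := u
  fin_cases k
  · -- up-face: offsets `(1/2, s/6)`, `(-1/2, s/6)`, `(0, -s/3)`
    obtain ⟨⟨h1, r1, i1⟩, ⟨h2, r2, i2⟩, ⟨h3, r3, i3⟩⟩ := up_neighbours x
    simp only [Fin.zero_eta] at h ⊢
    rw [normSq_sub_eq] at h
    rcases descent_ineq h with hlt | hlt | hlt
    · exact ⟨_, h1, by rw [normSq_sub_eq, normSq_sub_eq, r1, i1]; linarith [hlt]⟩
    · exact ⟨_, h2, by rw [normSq_sub_eq, normSq_sub_eq, r2, i2]; linarith [hlt]⟩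
    · exact ⟨_, h3, by rw [normSq_sub_eq, normSq_sub_eq, r3, i3]; linarith [hlt]⟩
  · -- down-face: the opposite offsets; apply the inequality to `(-p, -q)`
    obtain ⟨⟨h1, r1, i1⟩, ⟨h2, r2, i2⟩, ⟨h3, r3, i3⟩⟩ := down_neighbours x
    simp only [Fin.mk_one] at h ⊢
    rw [normSq_sub_eq] at h
    have h' : 1 / 3 < (-(y.re - (hexCenter (x, 1)).re)) ^ 2 + (-(y.im - (hexCenter (x, 1)).im)) ^ 2 := by
      simpa only [neg_sq] using h
    rcases descent_ineq h' with hlt | hlt | hlt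
    · exact ⟨_, h1, by rw [normSq_sub_eq, normSq_sub_eq, r1, i1]; linarith [hlt]⟩
    · exact ⟨_, h2, by rw [normSq_sub_eq, normSq_sub_eq, r2, i2]; linarith [hlt]⟩
    · exact ⟨_, h3, by rw [normSq_sub_eq, normSq_sub_eq, r3, i3]; linarith [hlt]⟩

/-! ### Greedy descent -/

/-- The lattice vertices strictly closer to `y` than `v` form a finite set. [folklore] -/
private theorem finite_closer (v : HexVertex) (y : ℂ) :
    {u : HexVertex | Complex.normSq (y - hexCenter u) <
      Complex.normSq (y - hexCenter v)}.Finite := by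
  refine (finite_embMeshVertices_hex (isBounded_ball (x := y) (r := ‖y - hexCenter v‖))
    one_ne_zero).subset fun u hu => ?_
  rw [mem_setOf_eq, Complex.normSq_eq_norm_sq, Complex.normSq_eq_norm_sq,
    pow_lt_pow_iff_left₀ (norm_nonneg _) (norm_nonneg _) two_ne_zero] at hu
  rw [mem_embMeshVertices_iff, Complex.ofReal_one, one_mul, mem_ball, dist_eq_norm, norm_sub_rev]
  exact hu

/-- **Greedy descent.**  From every honeycomb vertex `v` and for every target point `y` there is
a walk ending within one edge length of `y` (`|y - c_z|² ≤ 1/3`) along which the distance to `y`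
never exceeds the initial one (it strictly decreases at each step). [folklore] -/
theorem exists_walk_normSq_le (v : HexVertex) (y : ℂ) :
    ∃ (z : HexVertex) (p : hexGraph.Walk v z), Complex.normSq (y - hexCenter z) ≤ 1 / 3 ∧
      ∀ u ∈ p.support, Complex.normSq (y - hexCenter u) ≤ Complex.normSq (y - hexCenter v) := by
  generalize hn : {u : HexVertex | Complex.normSq (y - hexCenter u) <
    Complex.normSq (y - hexCenter v)}.ncard = n
  induction n using Nat.strong_induction_on generalizing v with
  | _ n ih =>
    by_cases hle : Complex.normSq (y - hexCenter v) ≤ 1 / 3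
    · refine ⟨v, SimpleGraph.Walk.nil, hle, fun u hu => ?_⟩
      rw [SimpleGraph.Walk.support_nil, List.mem_singleton] at hu
      rw [hu]
    · obtain ⟨v', hadj, hlt⟩ := exists_adj_normSq_lt v y (lt_of_not_ge hle)
      have hsub : {u : HexVertex | Complex.normSq (y - hexCenter u) <
            Complex.normSq (y - hexCenter v')} ⊂
          {u : HexVertex | Complex.normSq (y - hexCenter u) <
            Complex.normSq (y - hexCenter v)} :=
        ⟨fun u hu => lt_trans hu hlt, fun hss => lt_irrefl _
          (show Complex.normSq (y - hexCenter v') < Complex.normSq (y - hexCenter v') from hss hlt)⟩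
      obtain ⟨z, p, hz, hp⟩ := ih _ (hn ▸ Set.ncard_lt_ncard hsub (finite_closer v y)) v' rfl
      refine ⟨z, SimpleGraph.Walk.cons hadj p, hz, fun u hu => ?_⟩
      rw [SimpleGraph.Walk.support_cons, List.mem_cons] at hu
      rcases hu with rfl | hu
      · exact le_rfl
      · exact (hp u hu).trans hlt.le

/-- **Greedy descent at mesh `δ`** (registered sub-goal `stub_canonicalTransfer_greedyPath` below):
from every vertex `v` and for every target `y ∈ ℂ` there is a honeycomb walk ending within
`δ/√3` (one rescaled edge length) of `y` along which `dist (δ c_u) y ≤ dist (δ c_v) y`: the walk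
stays in the closed disc around `y` through `δ c_v`. [folklore] -/
theorem exists_walk_dist_smul_le {δ : ℝ} (hδ : 0 < δ) (v : HexVertex) (y : ℂ) :
    ∃ (z : HexVertex) (p : hexGraph.Walk v z),
      dist ((δ : ℂ) * hexCenter z) y ≤ δ / Real.sqrt 3 ∧
      ∀ u ∈ p.support, dist ((δ : ℂ) * hexCenter u) y ≤ dist ((δ : ℂ) * hexCenter v) y := by
  have hδ0 : (δ : ℂ) ≠ 0 := Complex.ofReal_ne_zero.2 hδ.ne'
  -- rescale the target
  have key : ∀ u : HexVertex,
      dist ((δ : ℂ) * hexCenter u) y = δ * ‖(δ : ℂ)⁻¹ * y - hexCenter u‖ := by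
    intro u
    rw [dist_eq_norm, ← norm_neg, neg_sub,
      show y - (δ : ℂ) * hexCenter u = (δ : ℂ) * ((δ : ℂ)⁻¹ * y - hexCenter u) by
        rw [mul_sub, ← mul_assoc, mul_inv_cancel₀ hδ0, one_mul],
      norm_mul, Complex.norm_real, Real.norm_of_nonneg hδ.le]
  have hsq : ∀ u : HexVertex,
      ‖(δ : ℂ)⁻¹ * y - hexCenter u‖ = Real.sqrt (Complex.normSq ((δ : ℂ)⁻¹ * y - hexCenter u)) :=
    fun u => by rw [Complex.normSq_eq_norm_sq, Real.sqrt_sq (norm_nonneg _)]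
  obtain ⟨z, p, hz, hp⟩ := exists_walk_normSq_le v ((δ : ℂ)⁻¹ * y)
  refine ⟨z, p, ?_, fun u hu => ?_⟩
  · rw [key, hsq, div_eq_mul_inv]
    refine mul_le_mul_of_nonneg_left ?_ hδ.le
    rw [← Real.sqrt_inv]
    exact Real.sqrt_le_sqrt (hz.trans_eq (one_div _))
  · rw [key, key, hsq, hsq]
    exact mul_le_mul_of_nonneg_left (Real.sqrt_le_sqrt (hp u hu)) hδ.le

/-- **Registered sub-goal `stub_canonicalTransfer_greedyPath`** (crux item stmt-CriticalPhenomena-10472,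
line `floor-ratio-restriction-bootstrap`, stub `stub_canonicalTransfer`): greedy descent at mesh
`δ`, registry form of `exists_walk_dist_smul_le`. [folklore] -/
theorem stub_canonicalTransfer_greedyPath :
    ∀ (δ : ℝ) (v : HexVertex) (y : ℂ), 0 < δ →
    ∃ (z : HexVertex) (p : hexGraph.Walk v z),
      dist ((δ : ℂ) * hexCenter z) y ≤ δ / Real.sqrt 3 ∧
      ∀ u ∈ p.support, dist ((δ : ℂ) * hexCenter u) y ≤ dist ((δ : ℂ) * hexCenter v) y :=
  fun _ v y hδ => exists_walk_dist_smul_le hδ v y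

end Summit.CriticalPhenomena.SAWScalingLimit.Theorems.ObservableToSLE.FloorRatio

end
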